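import Summits.Ventures.HodgeRepro2.T5InertPlaceInertiaTrivial

/-!
# T5InertPlaceFrobenius — at an inert place the local conjugation reduces to the FROBENIUS of the
quadratic residue extension: `σ x ≡ x^{q_v} mod 𝔪_w`

Tier-5 kernel support (N3, the inert places) — p8, gen 15.  §8(d): uses an L-value-free
non-vanishing device: NO.

`T5InertPlaceInertiaTrivial` showed that at an inert place every `σ ≠ 1` in `Gal(L_w / K_v)` acts
non-trivially on the residue field `𝓀_w = 𝓀(O_Lw)`.  The residue extension `𝓀_w / 𝓀_v` is a
quadratic extension of finite fields (`f(w/v) = 2`, `T5InertGlobalToLocal`), whose Galois group is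
`{1, Frob}` with `Frob = (· ^ q_v)` (Mathlib's `FiniteField.frobeniusAlgEquivOfAlgebraic`), so
the reduction `σ̄` of `σ` — Mathlib's `IsLocalRing.ResidueField.mapAlgEquiv'` of the restriction
`galRestrict … σ : O_Lw ≃ₐ[O_Kv] O_Lw` — IS the Frobenius:
* `residue_galRestrict` — `σ̄ (residue x) = residue (σ x)`;
* `card_algEquiv_residueField_eq_two`, `frobenius_ne_one` — `Gal(𝓀_w / 𝓀_v) = {1, Frob}`;
* `mapAlgEquiv'_galRestrict_eq_frobenius` — **`σ̄ = Frob`**;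
* `residue_galRestrict_eq_pow` — **`residue (σ x) = (residue x)^{q_v}`** for every integer `x`.
-/

namespace Summit.Ventures.HodgeRepro2.T5InertPlaceFrobenius

open IsDedekindDomain HeightOneSpectrum NumberField

variable {K : Type*} [Field K] [NumberField K] (v : HeightOneSpectrum (RingOfIntegers K))
variable {L : Type*} [Field L] [NumberField L] [Algebra K L]
  (w : HeightOneSpectrum (RingOfIntegers L)) [w.asIdeal.LiesOver v.asIdeal]

/-- The reduction of `σ` to the residue fields sends `residue x` to `residue (σ x)`
(`σ` restricted to `O_Lw` through Mathlib's `galRestrict`). -/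
theorem residue_galRestrict (σ : w.adicCompletion L ≃ₐ[v.adicCompletion K] w.adicCompletion L)
    (x : w.adicCompletionIntegers L) :
    IsLocalRing.ResidueField.mapAlgEquiv' (galRestrict (v.adicCompletionIntegers K)
        (v.adicCompletion K) (w.adicCompletion L) (w.adicCompletionIntegers L) σ)
      (IsLocalRing.residue (w.adicCompletionIntegers L) x) =
      IsLocalRing.residue (w.adicCompletionIntegers L)
        (galRestrict (v.adicCompletionIntegers K) (v.adicCompletion K) (w.adicCompletion L)
          (w.adicCompletionIntegers L) σ x) :=
  IsLocalRing.ResidueField.mapAlgEquiv'_residue _ x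

/-- The action of `σ` on `O_Lw` of `T5InertPlaceInertiaTrivial` is `galRestrict … σ`. -/
theorem smul_eq_galRestrict (σ : w.adicCompletion L ≃ₐ[v.adicCompletion K] w.adicCompletion L)
    (x : w.adicCompletionIntegers L) :
    letI : MulSemiringAction (w.adicCompletion L ≃ₐ[v.adicCompletion K] w.adicCompletion L)
      (w.adicCompletionIntegers L) :=
      IsIntegralClosure.MulSemiringAction (v.adicCompletionIntegers K) (v.adicCompletion K)
        (w.adicCompletion L) (w.adicCompletionIntegers L)
    σ • x = galRestrict (v.adicCompletionIntegers K) (v.adicCompletion K) (w.adicCompletion L)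
      (w.adicCompletionIntegers L) σ x :=
  rfl

/-- At an inert place the reduction of `σ ≠ 1` is a non-trivial automorphism of `𝓀_w / 𝓀_v`. -/
theorem mapAlgEquiv'_galRestrict_ne_one (he : v.asIdeal.ramificationIdx' w.asIdeal = 1)
    (h2 : Module.finrank (v.adicCompletion K) (w.adicCompletion L) = 2)
    (σ : w.adicCompletion L ≃ₐ[v.adicCompletion K] w.adicCompletion L) (hσ : σ ≠ 1) :
    IsLocalRing.ResidueField.mapAlgEquiv' (galRestrict (v.adicCompletionIntegers K)
      (v.adicCompletion K) (w.adicCompletion L) (w.adicCompletionIntegers L) σ) ≠ 1 := by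
  intro h
  obtain ⟨x, hx⟩ := T5InertPlaceInertiaTrivial.exists_residue_smul_ne v w he h2 σ hσ
  apply hx
  rw [smul_eq_galRestrict, ← residue_galRestrict, h]
  rfl

/-- The residue extension at a place with `f(w/v) = 2` has a Galois group of order `2`. -/
theorem card_algEquiv_residueField_eq_two (hf : v.asIdeal.inertiaDeg' w.asIdeal = 2) :
    Nat.card (IsLocalRing.ResidueField (w.adicCompletionIntegers L) ≃ₐ[IsLocalRing.ResidueField
      (v.adicCompletionIntegers K)] IsLocalRing.ResidueField (w.adicCompletionIntegers L)) = 2 := by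
  rw [IsGalois.card_aut_eq_finrank, T5InertGlobalToLocal.finrank_residueField_eq_two_of_inert v w hf]

/-- The Frobenius of a quadratic extension of finite fields is not the identity. -/
theorem frobenius_ne_one (hf : v.asIdeal.inertiaDeg' w.asIdeal = 2) :
    letI := Fintype.ofFinite (IsLocalRing.ResidueField (v.adicCompletionIntegers K))
    FiniteField.frobeniusAlgEquivOfAlgebraic (IsLocalRing.ResidueField (v.adicCompletionIntegers K))
      (IsLocalRing.ResidueField (w.adicCompletionIntegers L)) ≠ 1 := by
  letI := Fintype.ofFinite (IsLocalRing.ResidueField (v.adicCompletionIntegers K))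
  intro h
  have := FiniteField.orderOf_frobeniusAlgEquivOfAlgebraic
    (IsLocalRing.ResidueField (v.adicCompletionIntegers K))
    (IsLocalRing.ResidueField (w.adicCompletionIntegers L))
  rw [h, orderOf_one, T5InertGlobalToLocal.finrank_residueField_eq_two_of_inert v w hf] at this
  exact absurd this (by norm_num)

/-- **THE LOCAL CONJUGATION REDUCES TO THE FROBENIUS**: at an inert place (`e = 1`, `f = 2`) the
reduction of every `σ ≠ 1` in `Gal(L_w / K_v)` is the Frobenius `(· ^ q_v)` of `𝓀_w / 𝓀_v`. -/
theorem mapAlgEquiv'_galRestrict_eq_frobenius (he : v.asIdeal.ramificationIdx' w.asIdeal = 1)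
    (hf : v.asIdeal.inertiaDeg' w.asIdeal = 2)
    (σ : w.adicCompletion L ≃ₐ[v.adicCompletion K] w.adicCompletion L) (hσ : σ ≠ 1) :
    letI := Fintype.ofFinite (IsLocalRing.ResidueField (v.adicCompletionIntegers K))
    IsLocalRing.ResidueField.mapAlgEquiv' (galRestrict (v.adicCompletionIntegers K)
      (v.adicCompletion K) (w.adicCompletion L) (w.adicCompletionIntegers L) σ) =
      FiniteField.frobeniusAlgEquivOfAlgebraic
        (IsLocalRing.ResidueField (v.adicCompletionIntegers K))
        (IsLocalRing.ResidueField (w.adicCompletionIntegers L)) := by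
  letI := Fintype.ofFinite (IsLocalRing.ResidueField (v.adicCompletionIntegers K))
  exact T5LocalConjugationRestriction.eq_of_ne_one_of_card_eq_two
    (card_algEquiv_residueField_eq_two v w hf)
    (mapAlgEquiv'_galRestrict_ne_one v w he
      (T5InertGlobalToLocal.finrank_adicCompletion_eq_two_of_inert v w he hf) σ hσ)
    (frobenius_ne_one v w hf)

/-- **`σ x ≡ x^{q_v} mod 𝔪_w`** for every integer `x` of `L_w`, `q_v = |𝓀_v|`: the local
conjugation at an inert place is the Frobenius on the residue field. -/
theorem residue_galRestrict_eq_pow (he : v.asIdeal.ramificationIdx' w.asIdeal = 1)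
    (hf : v.asIdeal.inertiaDeg' w.asIdeal = 2)
    (σ : w.adicCompletion L ≃ₐ[v.adicCompletion K] w.adicCompletion L) (hσ : σ ≠ 1)
    (x : w.adicCompletionIntegers L) :
    letI := Fintype.ofFinite (IsLocalRing.ResidueField (v.adicCompletionIntegers K))
    IsLocalRing.residue (w.adicCompletionIntegers L)
        (galRestrict (v.adicCompletionIntegers K) (v.adicCompletion K) (w.adicCompletion L)
          (w.adicCompletionIntegers L) σ x) =
      IsLocalRing.residue (w.adicCompletionIntegers L) x ^
        Fintype.card (IsLocalRing.ResidueField (v.adicCompletionIntegers K)) := by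
  letI := Fintype.ofFinite (IsLocalRing.ResidueField (v.adicCompletionIntegers K))
  rw [← residue_galRestrict, mapAlgEquiv'_galRestrict_eq_frobenius v w he hf σ hσ]
  rfl

end Summit.Ventures.HodgeRepro2.T5InertPlaceFrobenius
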